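import Summits.BirchSwinnertonDyer.BirchSwinnertonDyer.Theorems.PrintX9MuPartStabilizedDefs
import Literature.NumberTheory.EllipticCurves.HeegnerEnvelopeCoherentPairProofs
import HarnessLib

/-!
# Two WEAKER letters for the shared μ-residual of rows 9/10 — the principal-system letter `MuPartStabilizedPrincipal`
# and the coherent-pair letter `MuPartStabilizedCoherentPair` — with `MuPartStabilizedOfPrint → each`

Cell `pub/bsd-print-x9`, seat `bsd-trib-w-tld` (tribunal-w, g9; typing audit of the shared μ-letter before it becomes the
shared CRUX of route-BirchSwinnertonDyer-PrintX9 (under stmt-BirchSwinnertonDyer-27077) and route-BirchSwinnertonDyer-PrintX10b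
(under 27275); authored by that seat, LANDED VERBATIM by seat bsd-line-x10b-p1 LEAD g4 `--supports`
stmt-BirchSwinnertonDyer-23055, helper — crux 23055's skeleton v7 / census p628508 consume the same letter at the coherent `C`). Two STATEMENT ABBREVIATIONS (`abbrev … : Prop` with a
body; NOT asserted, NOT named facts, no citation tag on the abbrevs — beyond-print residual letters, not published
results) and two one-step theorems; no `sorry`, no instance, no new definition of an object. ROUTE-INDEPENDENT (imports no
`Theses` file), like `PrintX9MuPartStabilizedDefs`. HONEST FRAMING: «beyond-print theorem»: no; BSD is NOT proved.

WHY. The shared letter `HeegnerMuPartStabilized.MuPartStabilizedOfPrint` (p625984) quantifies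
`∀ (C : CastellaGrossiLeeSkinner2022.StabilizedHeegnerData …)`. That interface pins the norm points `u_k`, `v_k` only as
norms of SOME Heegner point of the right conductor and orientation (`IsHeegnerNormPoint`), so the `∀` ranges over
layerwise Galois-INCOHERENT choices as well (module docstring of `CastellaGrossiLeeSkinner2022.HowardDivisibilityAnyClassNumber`).
Every consumer in the tree instantiates the letter ONLY at the engine's coherent datum `C₀` of
`exists_coherent_pair_envelope` (p624590 §2 → 27077; its row-10 twin → 27275; `…OfMuPartStabilizedOfPrint` → 23055), and
the road meant to prove it — Howard's `𝔮 = T^m + p` specialisation of the Λ-adic Kolyvagin system — runs on the PRINCIPAL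
Euler system (the tree's trace relations are those of Gross's points `x(n)`). Passing from the principal `C₀` to an
arbitrary instance `C` would take the Galois transitivity of Heegner points of conductor `p^j` and fixed orientation
(Shimura reciprocity — in the tree only as the NAMED FACT `heegnerPointOfConductor_one_galoisConj`, at conductor `1`,
«not provable in the tree today») plus a two-sided `ω_δ`-comparison `Λκ_∞(C) ~ Λκ_∞(C₀)` (a paper argument, REF-121 (4),
no tree declaration). The two letters below range over exactly what the road controls and what the closers consume:

* `MuPartStabilizedPrincipal` — the same inequality for stabilised data BUILT ON the principal `p`-power system: binders
  `x : ℕ → E(K̄)` over Gross's `x(p^j)` for `(C.Dt, C.β)` fixed by `Gal(K̄/K[p^j])`, transversals `A_k`, and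
  `u_k = Σ_{A_k} a • x_{d(k)}`, `v_k = Σ_{A_k} a • x_{d(k)-1}` — the letter of the `∃`-output of
  `exists_stabilizedHeegnerData_of_system`;
* `MuPartStabilizedCoherentPair` — for every `(Dt, β, D, X)` THERE IS a coherent pair `(C, F)` on `(Dt, β)` with
  `ℋ_∞(F) ≤ Λκ_∞(C)`, `g • Λκ_∞(C) ≤ ℋ_∞(F)` (`g ≠ 0`) and the inequality AT THAT `C` — the export list p624590 §2 consumes
  (extra binders: `p ∤ N` and the two tower inputs of the engine, `K_k ⊆ K[p^{k+1}]` and `[K[p] : K[1]] = p − 1`, which the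
  row frames discharge: `ClassX9.not_dvd_conductorNorm`, `AnticyclotomicTowerSharp`, `card_ringClassGalOver_prime_one_of_frame`).

`muPartStabilizedPrincipal_of_print`, `muPartStabilizedCoherentPair_of_print`: the `∀ C` letter implies each (the second
through the engine), so either is a WEAKER letter for the same closers; the companion file
`PrintX9HowardContainmentLightFramePinnedOfPrintSharpOfMuCoherentPair` re-plumbs p624590 §2 to the coherent-pair letter.
-/

set_option linter.dupNamespace false
set_option autoImplicit false

noncomputable section

open scoped Classical Pointwise
open Literature Literature.NumberTheory.EllipticCurves WeierstrassCurve

namespace Summit.BirchSwinnertonDyer.BirchSwinnertonDyer.Theorems.HeegnerMuPartStabilized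

/-- **(LP) The μ-part at `p ∣ h_K` for stabilised data ON THE PRINCIPAL SYSTEM.** Same prefix as
`MuPartStabilizedOfPrint`; the datum `C` comes with a system `x : ℕ → E(K̄)` over Gross's points `x(p^j)` of
orientation `C.β` for `C.Dt`, fixed by `Gal(K̄/K[p^j])`, and transversals `A_k` exhibiting `u_k`, `v_k` as the
`A_k`-norms of `x_{d(k)}`, `x_{d(k)-1}`. NOT asserted; no citation tag. -/
abbrev MuPartStabilizedPrincipal : Prop :=
  ∀ (N : ℕ) [NeZero N] (W : WeierstrassCurve ℚ) [W.IsGloballyMinimal] (K : Type) [Field K] [NumberField K]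
    (p : ℕ) [Fact p.Prime] (κ : ZpExtension K p) (γ : Field.absoluteGaloisGroup K)
    (jbar : AlgebraicClosure K →+* ℂ),
    CastellaGrossiLeeSkinner2022.Thm413Hypotheses N W K p κ γ →
    ¬ W.HasCM → W.HasIrreducibleModPGaloisRep p → (W.baseChange K).HasIrreducibleModPGaloisRep p →
    MastellaZerman2026.HasPadicScalarImage W p → SatisfiesHeegnerHypothesis p K →
    p ∣ NumberField.classNumber K →
    ∀ (D : (W.baseChange K).LambdaAdicSelmerData κ γ)
      (C : CastellaGrossiLeeSkinner2022.StabilizedHeegnerData N W K κ jbar)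
      (X : (W.baseChange K).SelmerDualData κ γ)
      (x : ℕ → WeierstrassCurve.geomPoints (W.baseChange K))
      (A : ℕ → Finset (Field.absoluteGaloisGroup K)),
    (∀ j, complexPoint W jbar (x j) =
      ModularForms.heegnerPointComplexOfConductor C.Dt (NumberField.discr K) C.β (p ^ j)) →
    (∀ j, ∀ σ ∈ ringClassSubgroup K (p ^ j) jbar, σ • x j = x j) →
    (∀ k, (∀ a ∈ A k, a ∈ κ.layerSubgroup k) ∧
      ∀ τ ∈ κ.layerSubgroup k, ∃! a, a ∈ A k ∧ a⁻¹ * τ ∈ ringClassSubgroup K (p ^ C.d k) jbar) →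
    (∀ k, C.u k = ∑ a ∈ A k, a • x (C.d k)) → (∀ k, C.v k = ∑ a ∈ A k, a • x (C.d k - 1)) →
    Module.Finite (IwasawaAlgebra p) D.S → Module.Finite (IwasawaAlgebra p) X.X →
    Module.IsTorsion (IwasawaAlgebra p) (D.S ⧸ CastellaGrossiLeeSkinner2022.stabilizedHeegnerModule D C) →
    ∀ 𝔭 : PrimeSpectrum (IwasawaAlgebra p), 𝔭.asIdeal = Ideal.span {(p : IwasawaAlgebra p)} →
      Module.lengthAt (IwasawaAlgebra p) (Submodule.torsion (IwasawaAlgebra p) X.X) 𝔭 ≤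
        2 * Module.lengthAt (IwasawaAlgebra p)
          (D.S ⧸ CastellaGrossiLeeSkinner2022.stabilizedHeegnerModule D C) 𝔭

/-- **`∀ C` letter ⟹ principal letter** (drop the principal-system binders): `MuPartStabilizedPrincipal` is WEAKER than
`MuPartStabilizedOfPrint`. [folklore] -/
theorem muPartStabilizedPrincipal_of_print (h : MuPartStabilizedOfPrint) : MuPartStabilizedPrincipal := by
  intro N _ W _ K _ _ p _ κ γ jbar hyp hCM hirr hirrK hsc hHp hhK D C X x A _ _ _ _ _ hfinS hfinX htor 𝔭 h𝔭
  exact h N W K p κ γ jbar hyp hCM hirr hirrK hsc hHp hhK D C X hfinS hfinX htor 𝔭 h𝔭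

/-- **(L∃) The μ-part at `p ∣ h_K`, the road EXPORTING its coherent pair.** Same prefix as `MuPartStabilizedOfPrint`, plus the two tower
inputs the engine takes (`K_k ⊆ K[p^{k+1}]`, `[K[p] : K[1]] = p − 1`) and `p ∤ N`; for every parametrisation `Dt`
at level `N`, orientation `β`, Selmer data `D`, `X`: THERE ARE a stabilised datum `C` and a Howard family `F` on
`(Dt, β)` with `ℋ_∞(F) ≤ Λκ_∞(C)`, `g • Λκ_∞(C) ≤ ℋ_∞(F)` for some `g ≠ 0`, and the μ-inequality AT THAT `C`.
NOT asserted; no citation tag. -/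
abbrev MuPartStabilizedCoherentPair : Prop :=
  ∀ (N : ℕ) [NeZero N] (W : WeierstrassCurve ℚ) [W.IsGloballyMinimal] (K : Type) [Field K] [NumberField K]
    (p : ℕ) [Fact p.Prime] (κ : ZpExtension K p) (γ : Field.absoluteGaloisGroup K)
    (jbar : AlgebraicClosure K →+* ℂ),
    CastellaGrossiLeeSkinner2022.Thm413Hypotheses N W K p κ γ →
    ¬ W.HasCM → W.HasIrreducibleModPGaloisRep p → (W.baseChange K).HasIrreducibleModPGaloisRep p →
    MastellaZerman2026.HasPadicScalarImage W p → SatisfiesHeegnerHypothesis p K →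
    p ∣ NumberField.classNumber K →
    ¬ p ∣ N →
    (∀ k, ringClassSubgroup K (p ^ (k + 1)) jbar ≤ κ.layerSubgroup k) →
    Nat.card (ringClassGalOver (jbar.comp (algebraMap K (AlgebraicClosure K))) p 1) = p - 1 →
    ∀ (Dt : ModularForms.ModularParametrizationData W N) (β : ℤ), (4 * N : ℤ) ∣ β ^ 2 - NumberField.discr K →
    ∀ (D : (W.baseChange K).LambdaAdicSelmerData κ γ) (X : (W.baseChange K).SelmerDualData κ γ),
    ∃ (C : CastellaGrossiLeeSkinner2022.StabilizedHeegnerData N W K κ jbar) (F : HeegnerFamily N W K κ jbar),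
      C.Dt = Dt ∧ F.Dt = Dt ∧ C.β = β ∧ F.β = β ∧
      heegnerModule D F ≤ CastellaGrossiLeeSkinner2022.stabilizedHeegnerModule D C ∧
      (∃ g : IwasawaAlgebra p, g ≠ 0 ∧
        g • CastellaGrossiLeeSkinner2022.stabilizedHeegnerModule D C ≤ heegnerModule D F) ∧
      (Module.Finite (IwasawaAlgebra p) D.S → Module.Finite (IwasawaAlgebra p) X.X →
        Module.IsTorsion (IwasawaAlgebra p)
          (D.S ⧸ CastellaGrossiLeeSkinner2022.stabilizedHeegnerModule D C) →
        ∀ 𝔭 : PrimeSpectrum (IwasawaAlgebra p), 𝔭.asIdeal = Ideal.span {(p : IwasawaAlgebra p)} →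
          Module.lengthAt (IwasawaAlgebra p) (Submodule.torsion (IwasawaAlgebra p) X.X) 𝔭 ≤
            2 * Module.lengthAt (IwasawaAlgebra p)
              (D.S ⧸ CastellaGrossiLeeSkinner2022.stabilizedHeegnerModule D C) 𝔭)

/-- **`∀ C` letter ⟹ coherent-pair letter**: run the engine `exists_coherent_pair_envelope` (CGLS Rem. 4.1.4 / Howard
Thm. 3.3.7 in the tree, any class number) and apply the `∀ C` letter at ITS `C`; so `MuPartStabilizedCoherentPair` is
WEAKER than `MuPartStabilizedOfPrint` given tree theorems. [cite: CastellaGrossiLeeSkinner2022, Rem. 4.1.4 (arXiv:2008.02571v2 TeX L2278–2294)]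
[cite: Howard2004HeegnerKolyvagin, §3.3 and Thm. 3.3.7] -/
theorem muPartStabilizedCoherentPair_of_print (h : MuPartStabilizedOfPrint) : MuPartStabilizedCoherentPair := by
  intro N _ W _ K _ _ p _ κ γ jbar hyp hCM hirr hirrK hsc hHp hhK hpN hTw1 hcardp Dt β hβ D X
  have hlev : N = W.conductorNorm ℤ := hyp.level
  subst hlev
  haveI : W.IsElliptic := hyp.isElliptic
  obtain ⟨C, F, hCDt, hFDt, hCβ, hFβ, hfwd, g, hg, hrev⟩ :=
    exists_coherent_pair_envelope (W := W) hyp.isImaginaryQuadratic hyp.heegner Dt hβ jbar hyp.ordinary hpN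
      κ hyp.topGenerator hTw1 hcardp hyp.noPTorsion D
  exact ⟨C, F, hCDt, hFDt, hCβ, hFβ, hfwd, ⟨g, hg, hrev⟩, fun hfinS hfinX htor 𝔭 h𝔭 ↦
    h _ W K p κ γ jbar hyp hCM hirr hirrK hsc hHp hhK D C X hfinS hfinX htor 𝔭 h𝔭⟩

end Summit.BirchSwinnertonDyer.BirchSwinnertonDyer.Theorems.HeegnerMuPartStabilized

end
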